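import Summits.BirchSwinnertonDyer.BirchSwinnertonDyer.Theorems.ResidualThetaTransportAtTwoResidualSignedLambdaLowerCMAtTwoStationRCongruence
import Summits.BirchSwinnertonDyer.BirchSwinnertonDyer.Theorems.ThetaPartnerAtTwoSignedKatoUpToAtTwoOmegaDivisionCharValues
import Summits.BirchSwinnertonDyer.BirchSwinnertonDyer.Theorems.ThetaPartnerAtTwoSignedKatoUpToAtTwoCuspFactorOddCharacters
import Summits.BirchSwinnertonDyer.BirchSwinnertonDyer.Theorems.ThetaPartnerAtTwoSignedKatoUpToAtTwoKatoBKTransport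
import Summits.BirchSwinnertonDyer.BirchSwinnertonDyer.Theorems.ThetaPartnerAtTwoSignedKatoUpToAtTwoKatoBKLevelIdentity
import Summits.BirchSwinnertonDyer.Rank1Residual.Additive.PadicClosureCyclotomicRoots
import HarnessLib

/-!
# Station (R) of line `onepair` (crux RSL_g, stmt-BirchSwinnertonDyer-22608) — file R4a: PREPARATIONS for the values assembly
# (evaluating `e` on a vector of `ℤ_p`-polynomials; the evaluated column congruence; an even primitive `ℚ̄₂`-valued character from a primitive
# `2^{2m}`-th root of unity of `ℂ₂`)

Route `ResidualThetaTransportAtTwo` (RTT), crux `ResidualSignedLambdaLowerCMAtTwo` (stmt-BirchSwinnertonDyer-22608), line `onepair` v3f, station (R)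
`stub_kzgValueRelation`. Seat `bsd-wall-tp2-p2x-w3` g18 (width seat; helper, `--supports … --as helper`, closes nothing). THEOREMS ONLY (no definition,
no instance, no notation, no `sorry`). BSD is not proved by anything here; 22608 / 26074 / 24105 OPEN / HOLD.

WHAT (memo `STATION-R-PORT-w3g18.md`, evidence #54 on 22608; plan step (P2)):
* `tsum_finset_sum_eval` — evaluation on `Λ_𝒪` commutes with finite sums.
* `tsum_apply_coe_eq_sum` (the BRIDGE) — for an additive `ι₀`-semilinear `e : ℤ_p⟦X⟧ⁿ → Λ_𝒪` and polynomials `t_i ∈ ℤ_p[X]`: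
  `e(t)(z) = Σ_i e(δ_i)(z) · t_i(z)` (`t_i(z)` = `eval₂` through `ℤ_p → ℂ_p`).
* `tsum_apply_eq_neg_mul_of_cong` (COL-ev for a vector) — from `ω_k ∣ P_i + c · cv_i` (all `i`): `e(P)(ζ−1) = −c(ζ−1) · e(cv)(ζ−1)` at `ζ^{p^k} = 1`.
* `exists_even_primitive_char_of_isPrimitiveRoot` (p = 2) — for `ζ ∈ ℂ₂` primitive of order `2^{2m}`, `m ≥ 1`: an EVEN PRIMITIVE Dirichlet character `ψ`
  mod `2^{2m+2}` with values in `ℚ̄₂` and `ψ(5) ↦ ζ`, together with its push-forward `χ = ψ ∘ (ℚ̄₂ → ℂ₂)` (even, `2`-power order, `χ(5) = ζ`) — the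
  characters at which (VALρ) (over `ℚ̄₂`) and H-MT (over `ℂ₂`) are read (`CoreChi.exists_even_char_apply_cyclotomicGenerator_eq`,
  `KatoBK.exists_mulChar_ringHomComp_eq`, `OddTwistSupply.isPrimitive_of_apply_ne_one`).

References: [Kobayashi2003] Thm. 6.2, (8.23) (p. 18); [Pollack2003] Prop. 6.18; [Washington1997] §7.2; [MazurTateTeitelbaum1986Invent] §I.13.
-/

set_option autoImplicit false
-- D-0017: single-problem summit, so `Summit.BirchSwinnertonDyer.BirchSwinnertonDyer.…` repeats a namespace BY DESIGN.
set_option linter.dupNamespace false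

noncomputable section

open scoped Classical
open Polynomial Literature.NumberTheory.EllipticCurves
  Summit.BirchSwinnertonDyer.Rank1Residual.Additive Summit.BirchSwinnertonDyer.Rank1Residual.Additive.PadicCyclotomicTower
  Summit.BirchSwinnertonDyer.BirchSwinnertonDyer.Theorems.SignedKatoOffTwo

namespace Summit.BirchSwinnertonDyer.BirchSwinnertonDyer.Theorems.ThetaTransport.StationR

/-! ## §1 Evaluation: finite sums, the bridge through `e`, the evaluated column congruence -/

section Generic

variable {p : ℕ} [Fact p.Prime] (S : Set (PadicAlgCl p))

/-- **Evaluation commutes with finite sums** on `Λ_𝒪`. [cite: Pollack2003, Prop. 6.18 (proof: plumbing)] -/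
theorem tsum_finset_sum_eval {ι : Type*} (s : Finset ι) (F : ι → IwasawaAlgebraO S) {z : ℂ_[p]} (hz : ‖z‖ < 1) :
    ∑' k, ((algebraMap (PadicAlgCl p) ℂ_[p]).comp (padicCoeffIntegers S).subtype) (PowerSeries.coeff k (∑ i ∈ s, F i)) * z ^ k =
      ∑ i ∈ s, ∑' k, ((algebraMap (PadicAlgCl p) ℂ_[p]).comp (padicCoeffIntegers S).subtype) (PowerSeries.coeff k (F i)) * z ^ k := by
  induction s using Finset.induction_on with
  | empty =>
    simp only [Finset.sum_empty, map_zero, zero_mul, tsum_zero]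
  | insert a s ha ih =>
    rw [Finset.sum_insert ha, Finset.sum_insert ha, tsum_add_eval S _ _ hz, ih]

/-- **Evaluation of `map ι₀ (t : ℤ_p[X])`** is the value of the polynomial (through `ℤ_p → ℚ_p → ℂ_p`).
[cite: Pollack2003, Prop. 6.18 (proof: plumbing)] -/
theorem tsum_map_coe_eval (t : ℤ_[p][X]) (z : ℂ_[p]) :
    ∑' k, ((algebraMap (PadicAlgCl p) ℂ_[p]).comp (padicCoeffIntegers S).subtype)
        (PowerSeries.coeff k (PowerSeries.map (padicIntToCoeffIntegers S) (t : PowerSeries ℤ_[p]))) * z ^ k =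
      t.eval₂ ((algebraMap ℚ_[p] ℂ_[p]).comp PadicInt.Coe.ringHom) z := by
  rw [← Polynomial.polynomial_map_coe, (hasSum_map_coeff_coe_mul_pow _ _ z).tsum_eq, Polynomial.eval₂_map]
  congr 1

/-- **The bridge through `e`.** For an additive `e : ℤ_p⟦X⟧ⁿ → Λ_𝒪` with `e(r • t) = r · e(t)` and a vector of POLYNOMIALS `t_i ∈ ℤ_p[X]`:
`e(t)(z) = Σ_i e(δ_i)(z) · t_i(z)` for `‖z‖ < 1`. [cite: Pollack2003, Prop. 6.18 (proof: plumbing)] -/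
theorem tsum_apply_coe_eq_sum {n : ℕ} (e : (Fin n → PowerSeries ℤ_[p]) →+ IwasawaAlgebraO S)
    (he : ∀ (r : PowerSeries ℤ_[p]) (t : Fin n → PowerSeries ℤ_[p]), e (r • t) = PowerSeries.map (padicIntToCoeffIntegers S) r * e t)
    (t : Fin n → ℤ_[p][X]) {z : ℂ_[p]} (hz : ‖z‖ < 1) :
    ∑' k, ((algebraMap (PadicAlgCl p) ℂ_[p]).comp (padicCoeffIntegers S).subtype)
        (PowerSeries.coeff k (e (fun i => (t i : PowerSeries ℤ_[p])))) * z ^ k =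
      ∑ i : Fin n, (∑' k, ((algebraMap (PadicAlgCl p) ℂ_[p]).comp (padicCoeffIntegers S).subtype)
          (PowerSeries.coeff k (e (Pi.single i 1))) * z ^ k) * (t i).eval₂ ((algebraMap ℚ_[p] ℂ_[p]).comp PadicInt.Coe.ringHom) z := by
  have hdec : (fun i => (t i : PowerSeries ℤ_[p])) = ∑ i : Fin n, (t i : PowerSeries ℤ_[p]) • (Pi.single i (1 : PowerSeries ℤ_[p])) := by
    funext j
    simp only [Finset.sum_apply, Pi.smul_apply, Pi.single_apply, smul_eq_mul, mul_ite, mul_one, mul_zero,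
      Finset.sum_ite_eq, Finset.mem_univ, if_true]
  rw [hdec, map_sum, tsum_finset_sum_eval S _ _ hz]
  refine Finset.sum_congr rfl fun i _ => ?_
  rw [he, mul_comm, tsum_mul_eval S _ _ hz, tsum_map_coe_eval]

/-- **COL-ev for a vector.** If `ω_k ∣ P_i + c · cv_i` for all `i` then, for `ζ^{p^k} = 1`:
`e(P)(ζ−1) = −(c(ζ−1)) · e(cv)(ζ−1)` (apply `e`, `P = ω • q − c • cv`, evaluate). [cite: Kobayashi2003, Thm. 6.2 and (8.23) (p. 18)] -/
theorem tsum_apply_eq_neg_mul_of_cong {n : ℕ} (k : ℕ) (P cv : Fin n → PowerSeries ℤ_[p]) (c : PowerSeries ℤ_[p])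
    (hcong : ∀ i, ((cyclotomicOmega p k).map (Int.castRingHom ℤ_[p]) : PowerSeries ℤ_[p]) ∣ P i + c * cv i)
    (e : (Fin n → PowerSeries ℤ_[p]) →+ IwasawaAlgebraO S)
    (he : ∀ (r : PowerSeries ℤ_[p]) (t : Fin n → PowerSeries ℤ_[p]), e (r • t) = PowerSeries.map (padicIntToCoeffIntegers S) r * e t)
    {ζ : ℂ_[p]} (hζ : ζ ^ p ^ k = 1) :
    ∑' j, ((algebraMap (PadicAlgCl p) ℂ_[p]).comp (padicCoeffIntegers S).subtype) (PowerSeries.coeff j (e P)) * (ζ - 1) ^ j =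
      -(∑' j, ((algebraMap (PadicAlgCl p) ℂ_[p]).comp (padicCoeffIntegers S).subtype)
          (PowerSeries.coeff j (PowerSeries.map (padicIntToCoeffIntegers S) c)) * (ζ - 1) ^ j) *
        ∑' j, ((algebraMap (PadicAlgCl p) ℂ_[p]).comp (padicCoeffIntegers S).subtype) (PowerSeries.coeff j (e cv)) * (ζ - 1) ^ j := by
  have hz : ‖ζ - 1‖ < 1 := norm_sub_one_lt_one_of_pow_prime_pow_eq_one hζ
  choose q hq using hcong
  have hP : P = ((cyclotomicOmega p k).map (Int.castRingHom ℤ_[p]) : PowerSeries ℤ_[p]) • q - c • cv := by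
    funext i
    simp only [Pi.sub_apply, Pi.smul_apply, smul_eq_mul]
    have := hq i
    linear_combination this
  have hdvd : PowerSeries.map (padicIntToCoeffIntegers S) ((cyclotomicOmega p k).map (Int.castRingHom ℤ_[p]) : PowerSeries ℤ_[p]) ∣
      e P - (-(PowerSeries.map (padicIntToCoeffIntegers S) c * e cv)) := by
    refine ⟨e q, ?_⟩
    rw [hP, map_sub, he, he]
    ring
  rw [tsum_eq_of_omega_dvd_sub S k hdvd hζ]
  have hneg : -(PowerSeries.map (padicIntToCoeffIntegers S) c * e cv) = PowerSeries.C (-1 : padicCoeffIntegers S) *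
      (PowerSeries.map (padicIntToCoeffIntegers S) c * e cv) := by
    rw [map_neg, map_one]; ring
  rw [hneg, tsum_C_mul_eval, tsum_mul_eval S _ _ hz]
  simp only [Subring.coe_neg, Subring.coe_one, map_neg, map_one]
  ring

end Generic

/-! ## §2 An even primitive `ℚ̄₂`-valued character from a primitive `2^{2m}`-th root of unity of `ℂ₂` -/

/-- **Characters from roots (p = 2).** For `m ≥ 1` and `ζ ∈ ℂ₂` primitive of order `2^{2m}` there are an EVEN `ℂ₂`-valued character `χ` mod `2^{2m+2}`
of `2`-power order with `χ(5) = ζ`, and an EVEN PRIMITIVE `ℚ̄₂`-valued character `ψ` mod `2^{2m+2}` with `ψ ∘ (ℚ̄₂ → ℂ₂) = χ` (so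
`algebraMap (ψ a) = χ a`; primitivity: `ψ(5)^{2^{2m−1}} ↦ ζ^{2^{2m−1}} ≠ 1`). [cite: Washington1997, §7.2] [cite: MazurTateTeitelbaum1986Invent, §I.13] -/
theorem exists_even_primitive_char_of_isPrimitiveRoot (m : ℕ) (hm : 1 ≤ m) {ζ : ℂ_[2]} (hζ : IsPrimitiveRoot ζ (2 ^ (2 * m))) :
    haveI : NeZero (2 ^ (2 * m + 2)) := ⟨pow_ne_zero _ two_ne_zero⟩
    ∃ (χ : DirichletCharacter ℂ_[2] (2 ^ (2 * m + 2))) (ψ : DirichletCharacter (PadicAlgCl 2) (2 ^ (2 * m + 2))),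
      χ.Even ∧ (∃ j : ℕ, orderOf χ = 2 ^ j) ∧ χ (5 : ZMod (2 ^ (2 * m + 2))) = ζ ∧
      ψ.ringHomComp (algebraMap (PadicAlgCl 2) ℂ_[2]) = χ ∧ (∀ a, χ a = algebraMap (PadicAlgCl 2) ℂ_[2] (ψ a)) ∧
      ψ (-1) = 1 ∧ DirichletCharacter.IsPrimitive ψ := by
  haveI : NeZero (2 ^ (2 * m + 2)) := ⟨pow_ne_zero _ two_ne_zero⟩
  obtain ⟨χ, heven, hord, hχ5⟩ : ∃ χ : DirichletCharacter ℂ_[2] (2 ^ (2 * m + 2)),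
      χ.Even ∧ (∃ j : ℕ, orderOf χ = 2 ^ j) ∧ χ (5 : ZMod (2 ^ (2 * m + 2))) = ζ := by
    have hce : cyclotomicExponent 2 = 2 := rfl
    have hcg5 : cyclotomicGenerator 2 = 5 := rfl
    have h := CoreChi.exists_even_char_apply_cyclotomicGenerator_eq (2 * m) hζ.pow_eq_one
    rw [hce, hcg5] at h
    simpa only [Nat.cast_ofNat] using h
  -- descend to `ℚ̄₂`
  have hinj : Function.Injective (algebraMap (PadicAlgCl 2) ℂ_[2]) := (algebraMap (PadicAlgCl 2) ℂ_[2]).injective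
  have hχpow : ∀ a : (ZMod (2 ^ (2 * m + 2)))ˣ, χ (a : ZMod (2 ^ (2 * m + 2))) ^ 2 ^ (2 * m + 2) = 1 :=
    KatoBK.apply_pow_two_pow_eq_one (2 * m) χ
  obtain ⟨ψ, hψ⟩ := KatoBK.exists_mulChar_ringHomComp_eq (algebraMap (PadicAlgCl 2) ℂ_[2]) hinj (NeZero.pos _)
    (isPrimitiveRoot_zeta 2 (2 * m + 2)) χ hχpow
  have hχa : ∀ a : ZMod (2 ^ (2 * m + 2)), χ a = algebraMap (PadicAlgCl 2) ℂ_[2] (ψ a) := fun a ↦ by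
    rw [← hψ, MulChar.ringHomComp_apply]
  have hevenψ : ψ (-1) = 1 := hinj (by rw [← hχa, heven, map_one])
  -- primitivity from the order of `ζ`
  have hprimψ : DirichletCharacter.IsPrimitive ψ := by
    refine OddTwistSupply.isPrimitive_of_apply_ne_one (PadicAlgCl 2) (e := 2 * m + 2) (by omega) ψ ?_
    intro h1
    have h2 : χ (((5 ^ 2 ^ (2 * m + 2 - 3) : ℕ) : ZMod (2 ^ (2 * m + 2)))) = 1 := by rw [hχa, h1, map_one]
    rw [Nat.cast_pow, Nat.cast_ofNat, map_pow, hχ5] at h2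
    have hlt : 2 ^ (2 * m + 2 - 3) < 2 ^ (2 * m) := Nat.pow_lt_pow_right (by norm_num) (by omega)
    exact hζ.pow_ne_one_of_pos_of_lt (pow_ne_zero _ two_ne_zero) hlt h2
  exact ⟨χ, ψ, heven, hord, hχ5, hψ, hχa, hevenψ, hprimψ⟩

end Summit.BirchSwinnertonDyer.BirchSwinnertonDyer.Theorems.ThetaTransport.StationR

end
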